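import Mathlib
import Summits.Ventures.HodgeRepro.Tier4.Common.AdelicDefs
import Summits.Ventures.HodgeRepro.Tier4.Line1.LocallyCompactGA
import Summits.Ventures.HodgeRepro.Tier4.Line1.SecondCountableGA
import Summits.Ventures.HodgeRepro.Tier4.Line1.CocompactReduction

/-!
# Tier4/Line1/SigmaCompactGA — `U(W)(𝔸_k)` is σ-compact; (I1-d) of LINE L1 reduced to (I1-c) alone

Blind re-derivation cell `pub-hodge-repro`, Tier 4 (README §9–§10), seat t4-L1-p5 (prover, LINE L1, gen 0).
With (I1-g) `locallyCompact_GA` and (I1-h) `secondCountable_GA` in the kernel, `U(W)(𝔸_k)` is σ-compact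
(Mathlib's `sigmaCompactSpace_of_locallyCompact_secondCountable`), and the generic unimodularity lemma of
`Tier4/Line1/RightInvariantOfFundamentalDomain.lean` applies: EVERY Haar measure on `U(W)(𝔸_k)` admitting a relatively
compact fundamental domain of `U(W)(k)` is right invariant.  So (I1-d) `haar_rightInvariant` (Skeleton v0.10 L638)
follows from (I1-c) `quotient_compact` (L614) and NOTHING ELSE — the only residual of (I1-c/c′/c″/d) is the
cocompactness of the rational points (Borel–Harish-Chandra / Fujisaki), see proofs/t4/L1/I1-c-CENSUS.md.

Nothing here says anything about the status of the Hodge conjecture for CM abelian varieties, which is NOT proved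
(HC_CM is NOT proved by anyone in this repository).
-/

set_option autoImplicit false

noncomputable section

namespace Summit.Ventures.HodgeRepro.Tier4.Line1

open NumberField Common MeasureTheory Topology TopologicalSpace

section Instance

variable {k : Type} [Field k] [NumberField k] (W : PlaneData k)

/-- **`U(W)(𝔸_k)` is σ-compact** (locally compact and second countable). -/
theorem sigmaCompact_GA : SigmaCompactSpace (GA W) := by
  haveI := locallyCompact_GA W
  haveI := secondCountable_GA W
  infer_instance

/-- (I1-d) REDUCED TO (I1-c) ALONE (Skeleton.lean L638): a Haar measure on `U(W)(𝔸_k)` with a relatively compact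
fundamental domain of `U(W)(k)` is right invariant. -/
theorem haar_rightInvariant_of_quotient_compact' [MeasurableSpace (GA W)] [BorelSpace (GA W)]
    (μ : Measure (GA W)) [μ.IsHaarMeasure]
    (hq : ∃ D : Set (GA W), IsFundamentalDomain (rationalPoints W) D μ ∧ IsCompact (closure D)) :
    μ.IsMulRightInvariant := by
  haveI := locallyCompact_GA W
  haveI := sigmaCompact_GA W
  exact haar_rightInvariant_of_quotient_compact W μ hq

/-- (I1-d) from (I1-c) in the registered shape: if `quotient_compact` holds for every Haar measure (the registered
(I1-c) statement, with its `IsDefinite` hypothesis carried along), then `haar_rightInvariant` holds. -/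
theorem haar_rightInvariant_of_quotient_compact_forall [MeasurableSpace (GA W)] [BorelSpace (GA W)]
    (hc : ∀ (μ : Measure (GA W)) [μ.IsHaarMeasure],
      ∃ D : Set (GA W), IsFundamentalDomain (rationalPoints W) D μ ∧ IsCompact (closure D))
    (μ : Measure (GA W)) [μ.IsHaarMeasure] : μ.IsMulRightInvariant :=
  haar_rightInvariant_of_quotient_compact' W μ (hc μ)

/-- A Haar measure on `U(W)(𝔸_k)` EXISTS (Mathlib's `MeasureTheory.Measure.haar`, which needs local compactness):
the measure the costume `line1_realise` has to supply. -/
theorem exists_isHaarMeasure_GA [MeasurableSpace (GA W)] [BorelSpace (GA W)] :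
    ∃ μ : Measure (GA W), μ.IsHaarMeasure := by
  haveI := locallyCompact_GA W
  exact ⟨Measure.haar, inferInstance⟩

/-- The torus `T = U(W₀) × U(W₁)` is closed in `U(W)(𝔸_k)` (two continuous matrix equations in a Hausdorff ring). -/
theorem isClosed_torusT : IsClosed ((torusT W : Subgroup (GA W)) : Set (GA W)) := by
  haveI := t2Space_adeleRing k
  have hc : Continuous fun g : GA W => GA.mat W g :=
    Units.continuous_val.comp continuous_subtype_val
  have h : ∀ A : Matrix (Fin 4) (Fin 4) k, IsClosed ((commutant W A : Subgroup (GA W)) : Set (GA W)) :=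
    fun A => isClosed_eq (hc.mul continuous_const) (continuous_const.mul hc)
  exact (h (W.P 0)).inter (h (W.P 1))

/-- The torus `T′` is closed in `U(W)(𝔸_k)`. -/
theorem isClosed_torusT' : IsClosed ((torusT' W : Subgroup (GA W)) : Set (GA W)) := by
  haveI := t2Space_adeleRing k
  have hc : Continuous fun g : GA W => GA.mat W g :=
    Units.continuous_val.comp continuous_subtype_val
  have h : ∀ A : Matrix (Fin 4) (Fin 4) k, IsClosed ((commutant W A : Subgroup (GA W)) : Set (GA W)) :=
    fun A => isClosed_eq (hc.mul continuous_const) (continuous_const.mul hc)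
  exact (h (W.Q 0)).inter (h (W.Q 1))

/-- `T` is locally compact (closed in the locally compact `U(W)(𝔸_k)`). -/
theorem locallyCompact_torusT : LocallyCompactSpace (torusT W) := by
  haveI := locallyCompact_GA W
  exact (isClosed_torusT W).locallyCompactSpace

/-- `T′` is locally compact. -/
theorem locallyCompact_torusT' : LocallyCompactSpace (torusT' W) := by
  haveI := locallyCompact_GA W
  exact (isClosed_torusT' W).locallyCompactSpace

/-- `T` is second countable. -/
theorem secondCountable_torusT : SecondCountableTopology (torusT W) := by
  haveI := secondCountable_GA W
  exact IsEmbedding.subtypeVal.secondCountableTopology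

/-- `T′` is second countable. -/
theorem secondCountable_torusT' : SecondCountableTopology (torusT' W) := by
  haveI := secondCountable_GA W
  exact IsEmbedding.subtypeVal.secondCountableTopology

/-- A Haar measure on `T` exists. -/
theorem exists_isHaarMeasure_torusT [MeasurableSpace (torusT W)] [BorelSpace (torusT W)] :
    ∃ μT : Measure (torusT W), μT.IsHaarMeasure := by
  haveI := locallyCompact_torusT W
  exact ⟨Measure.haar, inferInstance⟩

/-- A Haar measure on `T′` exists. -/
theorem exists_isHaarMeasure_torusT' [MeasurableSpace (torusT' W)] [BorelSpace (torusT' W)] :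
    ∃ μT' : Measure (torusT' W), μT'.IsHaarMeasure := by
  haveI := locallyCompact_torusT' W
  exact ⟨Measure.haar, inferInstance⟩

end Instance

end Summit.Ventures.HodgeRepro.Tier4.Line1

end
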